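import Mathlib
import HarnessLib

/-!
# Route `KLProgramme` — crux K3 ENGINE (stmt-HubbardSuperconductivity-20437 `KLRegimeEngineV17F2`), located item «(e)-D-ROWS», two-volume Lipschitz tower:
# the CLOSING ARITHMETIC of the geometric-budget law of rows (cell gate-hubbard-kl, seat hubbard-kl-k3c4-p1 g25, VL lane; memo DROWS-SCOPE-g25.md §13.10)

`…TwoVolumeLipLawOfRowsBase1.klLipBornDiffSup_le_law_of_rows_base1` (p726742) closes the two-volume tower modulo seven ARITHMETIC hypotheses on the budget
`Θ`, the difference profile `Y`, its four-piece constants `κ₁ κ₂ κ₃ Aν` and the step constants `C`: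
`hχΘ : χ_m < Θ`, `hY0`, `hYenv : a_mχ_mX_b m/(1 − χ_m/Θ) + a₁_m(χ_m/Θ)Y_m + ΔX_m ≤ Y_m`, `hY1–hY3`, `hYm`, `hCS : C p + S p ≤ Θ·X_b p`
(`a_m = (2ZC_J²)^m`, `χ_m = (32/2^m)^d`, `a₁_m = C_J^{2m}`).  This file discharges them by an explicit choice (pure real arithmetic, no model object):

* **`geomClosing_profile`** — with a born law `X_b` of four-piece shape `(i₁λ, i₂λ, i₃λ², Aλ^{m−1}Q^m)` (E1's W-law shape), source rows `ΔX` of four-piece shape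
  `(δ₁λ, δ₂λ, δ₃λ², δ_Aλ^{m−1}Q′^m)`, and a budget `Θ ≥ 1` with `2χ_m ≤ Θ`,
  `2a₁_mχ_m ≤ Θ` (`1 ≤ m ≤ D`), the profile **`Y_m := 4a_mχ_mX_b m + 2ΔX_m`** satisfies `hχΘ`, `hY0`, `hYenv`, and — given the jump-cost absorption
  **`2ZC_J²·Q ≤ 2^d·Q′`** (the block length `d` absorbs the per-leg-pair jump cost, exactly as in the one-volume tower) — the four-piece bounds `hY1 hY2 hY3 hYm` with
  `κ₁ = 4(2ZC_J²)16^d i₁ + 2δ₁`, `κ₂ = 4(2ZC_J²)²8^d i₂ + 2δ₂`, `κ₃ = 4(2ZC_J²)³4^d i₃ + 2δ₃`, `Aν = 4·32^d·A + 2δ_A`;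
* `geomClosing_theta` (g25 append) — the explicit budget `Θ := 2(1 + C_J²)16^d + (c₀ + s₀)` under `C_J² ≤ 2^d` (`Θ ≍ 16^d`, memo §13.9);
* **`geomClosing_budget`** — `hCS` from RELATIVE bounds `C p ≤ c₀X_b p`, `S p ≤ s₀X_b p` and `c₀ + s₀ ≤ Θ`;
* **`stepConst_le_ratio`** — the relative bound for the high-degree step constant: under T3's `4Q′ ≤ Q` and `2τ̄ψ̄Q′ ≤ Q`,
  `Aν λ^{p−1}(4Q′)^p X₁ + E ψ̄^p (2τ̄Q′λ)^{p−1} T ≤ (AνX₁/A + Eψ̄T/(QA))·(Aλ^{p−1}Q^p)` for every `p ≥ 1`.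
Nothing about the model is asserted; nothing asserts the (D) rows, (e), any stub, VL, K3 or superconductivity.
References: BGM 2006 §3 [cite: BenfattoGiulianiMastropietro2006]; FST2 [cite: FeldmanSalmhoferTrubowitz1998].
-/

noncomputable section

namespace Summit.HubbardSuperconductivity.HubbardSuperconductivity.Theorems.EngineV8

set_option linter.dupNamespace false -- summit = problem name (single-conjunct summit), D-0017

open Finset Real

/-- The row factor identity `(32/2^m)^d = 32^d/(2^d)^m`. -/
theorem chi_eq (d m : ℕ) : ((32 : ℝ) / 2 ^ m) ^ d = (32 : ℝ) ^ d / ((2 : ℝ) ^ d) ^ m := by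
  rw [div_pow, ← pow_mul, ← pow_mul, mul_comm]

/-- **Closing arithmetic, profile part.**  With a born law `X_b` of four-piece shape `(i₁λ, i₂λ, i₃λ², Aλ^{m−1}Q^m)`, source rows `ΔX` of four-piece shape
`(δ₁λ, δ₂λ, δ₃λ², δ_Aλ^{m−1}Q′^m)`, a budget
`Θ ≥ 1` dominating `2χ_m` and `2a₁_mχ_m`, and the jump-cost absorption `2ZC_J²Q ≤ 2^dQ′`, the profile `Y_m := 4a_mχ_mX_b m + 2ΔX_m` satisfies the hypotheses
`hχΘ hY0 hYenv hY1 hY2 hY3 hYm` of `klLipBornDiffSup_le_law_of_rows_base1` with the explicit four-piece constants of the docstring. -/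
theorem geomClosing_profile {D d : ℕ} {Z CJ i₁ i₂ i₃ A lam Q Q' δ₁ δ₂ δ₃ δA Θ : ℝ} {Xb ΔX : ℕ → ℝ}
    (hZ : 0 ≤ Z) (hA : 0 ≤ A) (hlam : 0 ≤ lam) (hQ : 0 ≤ Q) (hXb0 : ∀ m, 0 ≤ Xb m)
    (hXb1 : Xb 1 = i₁ * lam) (hXb2 : Xb 2 = i₂ * lam) (hXb3 : Xb 3 = i₃ * lam ^ 2) (hXbm : ∀ m, 4 ≤ m → m ≤ D → Xb m = A * lam ^ (m - 1) * Q ^ m)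
    (hΔ0 : ∀ m, 0 ≤ ΔX m) (hΔ1 : ΔX 1 ≤ δ₁ * lam) (hΔ2 : ΔX 2 ≤ δ₂ * lam) (hΔ3 : ΔX 3 ≤ δ₃ * lam ^ 2)
    (hΔm : ∀ m, 4 ≤ m → m ≤ D → ΔX m ≤ δA * lam ^ (m - 1) * Q' ^ m)
    (hΘ1 : 1 ≤ Θ) (hΘχ : ∀ m, 1 ≤ m → m ≤ D → 2 * (((32 : ℝ) / 2 ^ m) ^ d) ≤ Θ)
    (hΘa : ∀ m, 1 ≤ m → m ≤ D → 2 * (CJ ^ (2 * m) * (((32 : ℝ) / 2 ^ m) ^ d)) ≤ Θ)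
    (habs : 2 * Z * CJ ^ 2 * Q ≤ (2 : ℝ) ^ d * Q') :
    let Yp : ℕ → ℝ := fun m => 4 * ((2 * Z * CJ ^ 2) ^ m * (((32 : ℝ) / 2 ^ m) ^ d) * Xb m) + 2 * ΔX m
    (∀ m, 1 ≤ m → m ≤ D → (fun m : ℕ => (((32 : ℝ) / 2 ^ m) ^ d)) m < Θ) ∧
    (∀ m, 1 ≤ m → m ≤ D → 0 ≤ Yp m) ∧
    (∀ m, 1 ≤ m → m ≤ D →
      (fun m : ℕ => (2 * Z * CJ ^ 2) ^ m) m * (fun m : ℕ => (((32 : ℝ) / 2 ^ m) ^ d)) m * Xb m / (1 - (fun m : ℕ => (((32 : ℝ) / 2 ^ m) ^ d)) m / Θ) +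
        (fun m : ℕ => CJ ^ (2 * m)) m * ((fun m : ℕ => (((32 : ℝ) / 2 ^ m) ^ d)) m / Θ) * Yp m + ΔX m ≤ Yp m) ∧
    Yp 1 ≤ (4 * (2 * Z * CJ ^ 2) * (16 : ℝ) ^ d * i₁ + 2 * δ₁) * lam ∧
    Yp 2 ≤ (4 * (2 * Z * CJ ^ 2) ^ 2 * (8 : ℝ) ^ d * i₂ + 2 * δ₂) * lam ∧
    Yp 3 ≤ (4 * (2 * Z * CJ ^ 2) ^ 3 * (4 : ℝ) ^ d * i₃ + 2 * δ₃) * lam ^ 2 ∧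
    (∀ m, 4 ≤ m → m ≤ D → Yp m ≤ (4 * (32 : ℝ) ^ d * A + 2 * δA) * lam ^ (m - 1) * Q' ^ m) := by
  intro Yp
  have hχ0 : ∀ m : ℕ, 0 ≤ ((32 : ℝ) / 2 ^ m) ^ d := fun m => by positivity
  have ha0 : ∀ m : ℕ, 0 ≤ (2 * Z * CJ ^ 2) ^ m := fun m => by positivity
  have hY0 : ∀ m, 0 ≤ Yp m := fun m => by
    have := hXb0 m; have := hΔ0 m; have := hχ0 m; have := ha0 m
    simp only [Yp]; positivity
  have hΘ0 : 0 < Θ := by linarith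
  refine ⟨fun m hm hmD => ?_, fun m _ _ => hY0 m, fun m hm hmD => ?_, ?_, ?_, ?_, fun m hm4 hmD => ?_⟩
  · -- hχΘ
    have h := hΘχ m hm hmD
    have hχ := hχ0 m
    show ((32 : ℝ) / 2 ^ m) ^ d < Θ
    by_contra hc; have hc := not_lt.mp hc; nlinarith
  · -- hYenv
    simp only
    set χ := ((32 : ℝ) / 2 ^ m) ^ d with hχdef
    set a := (2 * Z * CJ ^ 2) ^ m
    have hχ := hχ0 m
    have hq : χ / Θ ≤ 1 / 2 := by
      rw [div_le_iff₀ hΘ0]; have := hΘχ m hm hmD; linarith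
    have hq1 : CJ ^ (2 * m) * (χ / Θ) ≤ 1 / 2 := by
      rw [← mul_div_assoc, div_le_iff₀ hΘ0]; have := hΘa m hm hmD; linarith
    have h1 : a * χ * Xb m / (1 - χ / Θ) ≤ 2 * (a * χ * Xb m) := by
      rw [div_le_iff₀ (by linarith)]
      have : 0 ≤ a * χ * Xb m := by have := hXb0 m; have := ha0 m; positivity
      nlinarith
    have h2 : CJ ^ (2 * m) * (χ / Θ) * Yp m ≤ 1 / 2 * Yp m := mul_le_mul_of_nonneg_right hq1 (hY0 m)
    have hYdef : Yp m = 4 * (a * χ * Xb m) + 2 * ΔX m := rfl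
    rw [hYdef] at h2 ⊢
    linarith
  · -- hY1
    show 4 * ((2 * Z * CJ ^ 2) ^ 1 * (((32 : ℝ) / 2 ^ 1) ^ d) * Xb 1) + 2 * ΔX 1 ≤ _
    rw [hXb1, pow_one, pow_one, show (32 : ℝ) / 2 = 16 by norm_num]
    nlinarith
  · -- hY2
    show 4 * ((2 * Z * CJ ^ 2) ^ 2 * (((32 : ℝ) / 2 ^ 2) ^ d) * Xb 2) + 2 * ΔX 2 ≤ _
    rw [hXb2, show (32 : ℝ) / 2 ^ 2 = 8 by norm_num]
    nlinarith
  · -- hY3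
    show 4 * ((2 * Z * CJ ^ 2) ^ 3 * (((32 : ℝ) / 2 ^ 3) ^ d) * Xb 3) + 2 * ΔX 3 ≤ _
    rw [hXb3, show (32 : ℝ) / 2 ^ 3 = 4 by norm_num]
    nlinarith
  · -- hYm
    show 4 * ((2 * Z * CJ ^ 2) ^ m * (((32 : ℝ) / 2 ^ m) ^ d) * Xb m) + 2 * ΔX m ≤ _
    rw [hXbm m hm4 hmD, chi_eq]
    have hd := hΔm m hm4 hmD
    have h2d : (0 : ℝ) < (2 : ℝ) ^ d := by positivity
    -- the main term: (2ZCJ²)^m · 32^d/(2^d)^m · A λ^{m−1} Q^m = 32^d A λ^{m−1} (2ZCJ²Q/2^d)^m ≤ 32^d A λ^{m−1} Q'^m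
    have hrat : 2 * Z * CJ ^ 2 * Q / (2 : ℝ) ^ d ≤ Q' := by rw [div_le_iff₀ h2d]; linarith
    have hrat0 : 0 ≤ 2 * Z * CJ ^ 2 * Q / (2 : ℝ) ^ d := by positivity
    have hpow : (2 * Z * CJ ^ 2 * Q / (2 : ℝ) ^ d) ^ m ≤ Q' ^ m := pow_le_pow_left₀ hrat0 hrat m
    have hmain : (2 * Z * CJ ^ 2) ^ m * ((32 : ℝ) ^ d / ((2 : ℝ) ^ d) ^ m) * (A * lam ^ (m - 1) * Q ^ m) =
        (32 : ℝ) ^ d * A * lam ^ (m - 1) * (2 * Z * CJ ^ 2 * Q / (2 : ℝ) ^ d) ^ m := by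
      rw [div_pow, mul_pow]; field_simp; rw [mul_pow, mul_pow, mul_pow]; ring
    rw [hmain]
    have hc : 0 ≤ (32 : ℝ) ^ d * A * lam ^ (m - 1) := by positivity
    have := mul_le_mul_of_nonneg_left hpow hc
    nlinarith

/-- **Closing arithmetic, budget part**: `hCS` of `klLipBornDiffSup_le_law_of_rows_base1` from relative bounds on the step and source constants. -/
theorem geomClosing_budget {D : ℕ} {Xb C S : ℕ → ℝ} {c₀ s₀ Θ : ℝ} (hXb0 : ∀ m, 0 ≤ Xb m)
    (hC : ∀ p, 1 ≤ p → p ≤ D → C p ≤ c₀ * Xb p) (hS : ∀ p, 1 ≤ p → p ≤ D → S p ≤ s₀ * Xb p) (hΘ : c₀ + s₀ ≤ Θ) :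
    ∀ p, 1 ≤ p → p ≤ D → C p + S p ≤ Θ * Xb p := fun p hp hpD => by
  have := hC p hp hpD; have := hS p hp hpD; have := hXb0 p; nlinarith

/-- **Relative bound for the high-degree step constant** (ratio form of T3's `hu₁ : 4Q′ ≤ Q`, `hu₂ : 2τ̄ψ̄Q′ ≤ Q`): for `p ≥ 1` and nonnegative data,
`Aν λ^{p−1}(4Q′)^p X₁ + E ψ̄^p (2τ̄Q′λ)^{p−1} T ≤ (AνX₁/A + Eψ̄T/(QA))·(Aλ^{p−1}Q^p)`. -/
theorem stepConst_le_ratio {Aν X₁ E ψ τ T A lam Q Q' : ℝ} (hAν : 0 ≤ Aν) (hX₁ : 0 ≤ X₁) (hE : 0 ≤ E) (hψ : 0 ≤ ψ) (hτ : 0 ≤ τ) (hT : 0 ≤ T)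
    (hA : 0 < A) (hlam : 0 ≤ lam) (hQ : 0 < Q) (hQ' : 0 ≤ Q') (hu₁ : 4 * Q' ≤ Q) (hu₂ : 2 * τ * ψ * Q' ≤ Q) {p : ℕ} (hp : 1 ≤ p) :
    Aν * lam ^ (p - 1) * (4 * Q') ^ p * X₁ + E * ψ ^ p * (2 * τ * Q' * lam) ^ (p - 1) * T ≤
      (Aν * X₁ / A + E * ψ * T / (Q * A)) * (A * lam ^ (p - 1) * Q ^ p) := by
  obtain ⟨q, rfl⟩ : ∃ q, p = q + 1 := ⟨p - 1, by omega⟩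
  simp only [Nat.add_sub_cancel]
  have h4 : (4 * Q') ^ (q + 1) ≤ Q ^ (q + 1) := pow_le_pow_left₀ (by positivity) hu₁ _
  have h2 : (2 * τ * ψ * Q') ^ q ≤ Q ^ q := pow_le_pow_left₀ (by positivity) hu₂ _
  -- first summand
  have hf : Aν * lam ^ q * (4 * Q') ^ (q + 1) * X₁ ≤ Aν * X₁ / A * (A * lam ^ q * Q ^ (q + 1)) := by
    rw [show Aν * X₁ / A * (A * lam ^ q * Q ^ (q + 1)) = Aν * lam ^ q * Q ^ (q + 1) * X₁ by field_simp]
    have : 0 ≤ Aν * lam ^ q := by positivity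
    have := mul_le_mul_of_nonneg_left h4 this
    exact mul_le_mul_of_nonneg_right this hX₁
  -- second summand: E ψ^{q+1} (2τQ'λ)^q T = E ψ T λ^q (2τψQ')^q ≤ E ψ T λ^q Q^q = (EψT/(QA))·(A λ^q Q^{q+1})
  have hs : E * ψ ^ (q + 1) * (2 * τ * Q' * lam) ^ q * T ≤ E * ψ * T / (Q * A) * (A * lam ^ q * Q ^ (q + 1)) := by
    have heq : E * ψ ^ (q + 1) * (2 * τ * Q' * lam) ^ q * T = E * ψ * T * lam ^ q * (2 * τ * ψ * Q') ^ q := by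
      rw [pow_succ, mul_pow, show (2 * τ * ψ * Q') ^ q = (2 * τ * Q') ^ q * ψ ^ q by rw [← mul_pow]; ring_nf]; ring
    have heq' : E * ψ * T / (Q * A) * (A * lam ^ q * Q ^ (q + 1)) = E * ψ * T * lam ^ q * Q ^ q := by
      rw [pow_succ]; field_simp
    rw [heq, heq']
    have : 0 ≤ E * ψ * T * lam ^ q := by positivity
    exact mul_le_mul_of_nonneg_left h2 this
  calc _ ≤ Aν * X₁ / A * (A * lam ^ q * Q ^ (q + 1)) + E * ψ * T / (Q * A) * (A * lam ^ q * Q ^ (q + 1)) := add_le_add hf hs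
    _ = _ := by ring

/-- The row factor at `m ≥ 1` is at most `16^d`: `(32/2^m)^d ≤ 16^d`. -/
theorem chi_le_sixteen_pow (d : ℕ) {m : ℕ} (hm : 1 ≤ m) : ((32 : ℝ) / 2 ^ m) ^ d ≤ (16 : ℝ) ^ d := by
  apply pow_le_pow_left₀ (by positivity)
  rw [div_le_iff₀ (by positivity)]
  have : (2 : ℝ) ≤ 2 ^ m := by
    calc (2 : ℝ) = 2 ^ 1 := by norm_num
      _ ≤ 2 ^ m := pow_le_pow_right₀ (by norm_num) hm
  nlinarith

/-- Under the absorption `C_J² ≤ 2^d`, the jump-weighted row factor at `m ≥ 1` is at most `C_J²·16^d`: `C_J^{2m}(32/2^m)^d ≤ C_J²·16^d`. -/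
theorem a1chi_le (d : ℕ) {CJ : ℝ} (habs : CJ ^ 2 ≤ (2 : ℝ) ^ d) {m : ℕ} (hm : 1 ≤ m) :
    CJ ^ (2 * m) * ((32 : ℝ) / 2 ^ m) ^ d ≤ CJ ^ 2 * (16 : ℝ) ^ d := by
  obtain ⟨q, rfl⟩ : ∃ q, m = q + 1 := ⟨m - 1, by omega⟩
  have h2d : (0 : ℝ) < (2 : ℝ) ^ d := by positivity
  -- CJ^{2(q+1)} (32/2^{q+1})^d = CJ² 16^d · (CJ²/2^d)^q
  have hid : CJ ^ (2 * (q + 1)) * ((32 : ℝ) / 2 ^ (q + 1)) ^ d = CJ ^ 2 * (16 : ℝ) ^ d * (CJ ^ 2 / (2 : ℝ) ^ d) ^ q := by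
    rw [chi_eq, div_pow, pow_succ ((2 : ℝ) ^ d) q, show (32 : ℝ) ^ d = (16 : ℝ) ^ d * (2 : ℝ) ^ d by rw [← mul_pow]; norm_num,
      pow_mul, pow_succ (CJ ^ 2) q]
    field_simp
  rw [hid]
  have hr : CJ ^ 2 / (2 : ℝ) ^ d ≤ 1 := by rw [div_le_one h2d]; exact habs
  have hrq : (CJ ^ 2 / (2 : ℝ) ^ d) ^ q ≤ 1 := pow_le_one₀ (by positivity) hr
  have hc : 0 ≤ CJ ^ 2 * (16 : ℝ) ^ d := by positivity
  nlinarith [mul_le_mul_of_nonneg_left hrq hc]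

/-- **Closing arithmetic, the budget `Θ = O(16^d)`**: under the absorption `C_J² ≤ 2^d`, the explicit budget `Θ := 2(1 + C_J²)·16^d + (c₀ + s₀)` (`c₀ + s₀ ≥ 0` the
relative step/source constants of `geomClosing_budget`) satisfies `1 ≤ Θ`, `2χ_m ≤ Θ`, `2a₁_mχ_m ≤ Θ` (`m ≥ 1`) and `c₀ + s₀ ≤ Θ` — the budget hypotheses of
`geomClosing_profile` / `geomClosing_budget`; this is the `Θ ≍ 16^d` of the β-ledger (memo §13.9). -/
theorem geomClosing_theta (d : ℕ) {CJ c₀ s₀ : ℝ} (habs : CJ ^ 2 ≤ (2 : ℝ) ^ d) (hcs : 0 ≤ c₀ + s₀) :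
    let Θ : ℝ := 2 * (1 + CJ ^ 2) * (16 : ℝ) ^ d + (c₀ + s₀)
    1 ≤ Θ ∧ (∀ m : ℕ, 1 ≤ m → 2 * (((32 : ℝ) / 2 ^ m) ^ d) ≤ Θ) ∧
      (∀ m : ℕ, 1 ≤ m → 2 * (CJ ^ (2 * m) * (((32 : ℝ) / 2 ^ m) ^ d)) ≤ Θ) ∧ c₀ + s₀ ≤ Θ := by
  intro Θ
  have h16 : (1 : ℝ) ≤ (16 : ℝ) ^ d := one_le_pow₀ (by norm_num)
  have hC2 : 0 ≤ CJ ^ 2 := by positivity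
  refine ⟨?_, fun m hm => ?_, fun m hm => ?_, ?_⟩
  · show (1 : ℝ) ≤ 2 * (1 + CJ ^ 2) * (16 : ℝ) ^ d + (c₀ + s₀); nlinarith
  · show 2 * (((32 : ℝ) / 2 ^ m) ^ d) ≤ 2 * (1 + CJ ^ 2) * (16 : ℝ) ^ d + (c₀ + s₀)
    have := chi_le_sixteen_pow d hm; nlinarith
  · show 2 * (CJ ^ (2 * m) * (((32 : ℝ) / 2 ^ m) ^ d)) ≤ 2 * (1 + CJ ^ 2) * (16 : ℝ) ^ d + (c₀ + s₀)
    have := a1chi_le d habs hm; nlinarith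
  · show c₀ + s₀ ≤ 2 * (1 + CJ ^ 2) * (16 : ℝ) ^ d + (c₀ + s₀); nlinarith

end Summit.HubbardSuperconductivity.HubbardSuperconductivity.Theorems.EngineV8

end
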